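import Literature.MathematicalPhysics.QuantumFieldTheory.Balaban1983to89.B5Prop11Plancherel
import Literature.MathematicalPhysics.QuantumFieldTheory.Balaban1983to89.B4Strip

/-!
# `Balaban1983to89.B5Eq129FreeResolventZoneSum` — T. Bałaban, *Propagators and renormalization transformations for lattice gauge theories. I*, Commun. Math.
# Phys. **95** (1984) 17–40 [Balaban1984PropagatorsI] (1.29)∕(1.31) p. 23 (the dual torus and the symbol `Δ(p) = Σ_μ|∂_μ(p)|²`), Prop. 1.1 p. 33, with
# *Regularity and decay of lattice Green's functions*, Commun. Math. Phys. **89** (1983) 571–597 [Balaban1983RegularityDecay] (2.49)–(2.51) pp. 585–586 (the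
# momentum representation of the free propagator, its integrand bounded for real momenta) and *Propagators for lattice gauge theories in a background field*,
# Commun. Math. Phys. **99** (1985) 389–434 [Balaban1985BackgroundPropagators] Thm 3.1 (3.42) p. 397: **(FS-b) THE LEVEL-FREE ZONE SUM —
# `Σ_{p ∈ Π_νℤ∕N_ν} (Δ_t(p) + m)^{−k} ≤ m^{d−k}·Π_ν (m⁻¹ + πN_ν∕(4t√m))` for every `d ≤ k`, `t > 0`, `m > 0` (`Δ_t(p) = Σ_ν t²(2 − 2Re χ_p(e_ν))`), and the
# level-free spectral constant `C₃² = m^{d−4}·c₀⁻¹·Π_ν((mN_ν)⁻¹ + π∕(4t√m))` (`d ≤ 4`) of the sup-norm bootstrap** (stone (FS-b) of the NE9 owner's plan v10;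
# (FS-a) = `B5Eq129FreeResolventSupBound`; the COMBINED LETTERS `hFS_tor` ∕ `hFS_tor_diag` ∕ `hFS_fine` = this file + (FS-a) live in the companion
# `B5Eq129FreeResolventZoneSumLetters`)

statement-level skeleton of published theorems with citation tags; proofs where landed; nothing here is a claim about the Yang–Mills mass gap

CITATION HEADER (lean-in-tree rule).  Audit cell `pub-balaban`, sub-cell `t4`, BINDER row NE9; filed by NE9 formalisation-swarm LEAF PROVER 02 (lineage
`b2b-balaban-t4-ne9-formalise-leaf-02`, gen 70) on the row OWNER `t4-ne9-p1` g89's WORD W-2 (journal [NE9P1-G89-W2]: *«(FS-b) THE LEVEL-FREE ZONE-SUM BOUND …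
YOURS IF YOU SAY «MINE» … TARGET SIGNATURES (i) zone_sum_le (hk : d ≤ k) … (ii) the COMBINED LETTER for d ≤ 4, k = 4: hFS_fine …»*; «MINE» = journal
[NE9LEAF02-G70-MINE-FSB]).  The OWNER's recipe ([NE9P1-G89-ONLINE]): *«DFT diagonalisation + 2 − 2cos θ ≥ (4∕π²)θ² + … factorising the d = 4 zone sum into four
1-D sums — the UV-convergence of ∫d⁴p∕(p²+M²)⁴»*; the product step *«each factor ≤ Δ+1 … NO AM–GM needed»* ([NE9P1-G89-W2]).  LOCATED PRECEDENT (Summits-side,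
not importable here, statements RE-TYPED not ported): `gan24-formalise-leaf-01` g55's `Summits/…/Beta/GAN24/ScalarFreeResolventDiagonal` (`sum_inv_sq_add_sq_le`,
`norm_char_sub_one_sq_ge`, `oneDim_sum_le ≤ 2 + M₁`, `norm_inv_pow_apply_le`) — here general mass `m`, general exponent `k ≥ d`, and an arctan TELESCOPE instead
of `2 + M₁`.  Sources READ first-hand in the held text layer (this seat, `paper:balaban1985-cmp99-background-propagators`, journal page = PDF page + 388): p. 397
Thm 3.1 *«There exist positive constants M₁, δ₀, a₀, B₀ dependent on d and L only … the operator G′(U) (a = 1) satisfies the inequalities |(G′(U)λ)(x)|, … ≤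
B₀e^{−δ₀d(y,y′)}|λ| … (3.42)»* (OCR-garbled glyphs; constants and position certain), p. 397 (3.39) *«Thus we have the supremum norms …»*, p. 398 *«We will prove
the above theorem by constructing a random walk representation …»* — NOTHING of that proof is reproduced; (1.29)∕(1.31) and (2.49)–(2.51) are the loci cited by
the tree's `B5Prop11Plancherel` (`Tor`, `chi`, `unitVec`, `sOf`, `abs_sOf_le`, `fine`) and `B4Strip` (`S1r = 2 − 2cos`, Jordan `S1r_ge`), consumed BY NAME.
The `[cite: …]` tags are TEXT LOCATIONS of the printed symbols only; every statement is `[folklore]` (ABSOLUTE RULE: nothing is minted as a cited fact).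

WHAT IS PROVED (sorry-free; 0 `def`; symbol written EXACTLY as in (FS-a): `Σ_ν t²(2 − 2(chi N p (unitVec N ν)).re)`).
* §1 ONE DIMENSION (two private calculus steps: the MVT inequality `(y−x)∕(1+y²) ≤ arctan y − arctan x` and the telescope `Σ_{v<K} b∕(1+b²(v+1)²) ≤ arctan(bK)`):
  **`sum_inv_quad_le`** (`Σ_{v<K} (c(v+1)² + M²)⁻¹ ≤ π∕(2√c·M)`), **`sum_zmod_inv_quad_le`** (`Σ_{q∈ℤ∕n} (c·valMinAbs(q)² + M²)⁻¹ ≤ (M²)⁻¹ + π∕(√c·M)`: the zero mode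
  plus two half-circles, each injected into `{1,…,n}`).
* §2 THE SYMBOL LETTER: **`two_sub_two_re_chi_unitVec`** (`2 − 2Re χ_p(e_ν) = S1r(sOf N p ν)`), **`letter_le_symbol`** (`16t²v_ν²∕N_ν² ≤ t²(2 − 2Re χ_p(e_ν))`,
  Jordan), `symbol_term_add_pos`.
* §3 **`prod_symbol_term_le_pow`** («each factor ≤ Δ_t + m»: `Π_ν(t²(2 − 2Re χ_p(e_ν)) + m) ≤ (Δ_t(p) + m)^d`), **`zone_sum_le`** (`d ≤ k`, `0 < t`, `0 < m`:
  `Σ_p((Δ_t(p) + m)^k)⁻¹ ≤ (m^{k−d})⁻¹·Π_ν(m⁻¹ + πN_ν∕(4t√m))` — `Fintype.prod_sum` factorisation + §1 per circle at `c = 16t²∕N_ν²`), `card_Tor_eq_prod`,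
  **`spectral_const_le`** (`d ≤ 4`: `(c₀|T|)⁻¹Σ_p(Δ_t+m)⁻⁴ ≤ (m^{4−d})⁻¹c₀⁻¹Π_ν((mN_ν)⁻¹ + π∕(4t√m))`).
* (§4, the combined letters `hFS_tor` ∕ `hFS_tor_diag` (`C₃ = √(3^d∕c₁)`) ∕ `hFS_fine` by (FS-a)'s `le_of_double_resolvent_weighted` + `spectral_const_le`:
  companion file `B5Eq129FreeResolventZoneSumLetters`.)
READING (zero weight).  At the diagonal `c₀t^d = 1` and `N_ν = t·ℓ_ν` (physical sides `ℓ_ν`): `C₃² = m^{d−4}·Π_ν(1∕(mℓ_ν) + π∕(4√m))` — no power of the level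
`t = η⁻¹`, decreasing in the volume, decaying in the mass like `m^{d∕2−4}` (the squared resolvent is what makes `d ≤ 4` summable: `∫_{ℝ^d}d^du∕(u² + m)⁴ < ∞`).
HONEST SCOPE.  [folklore] one-variable calculus (MVT for `arctan`), finite sums and products; crude explicit constants; FREE scalar Laplacian only (no background,
no `Q′*Q′`, no window); nothing of [B9] Thm 3.1 ∕ [B5] Prop. 1.1 asserted or valued.  NOT summit progress (cell pub-balaban: NE9 NOT PRINTED ∕ NOT PROVED; «NE9
⇐ the named binders»; row WALLED ON A MODEL (O-NE9-1; #5 UNRULED); spine PROVED 0∕9; rung (B)+1 finite T⁴ — NOT infinite volume, NOT mass gap, NOT BetaPertH,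
NOT Clay).  HONEST DEPENDENCY (cell line): continuum YM on T⁴ ⇐ BetaPertH ∧ nine spine estimates (0/9 proved); BetaPertH ⇐ (D1) ∧ (D4) ∧ CAP+tail; G-an2-4
gates asym, D1 and NE2/3/4.  NEW file importing `B5Prop11Plancherel` + `B4Strip` only; nothing modified.  Net new unproved facts: 0.
-/

noncomputable section

open scoped BigOperators ComplexConjugate

namespace Literature.MathematicalPhysics.QuantumFieldTheory.Balaban1983to89.B5Eq129FreeResolventZoneSum

open B5Prop11Plancherel (Tor chi unitVec chi_unitVec sOf abs_sOf_le fine)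
open B4Strip (S1r S1r_ge S1r_nonneg)

/-! ## §1 One-dimensional sums: the arctan telescope -/

/-- the mean-value step: `0 ≤ x ≤ y ⟹ (y − x)∕(1 + y²) ≤ arctan y − arctan x` (the derivative `1∕(1+s²)` is decreasing on `[0, ∞)`). [folklore] -/
private theorem sub_div_le_arctan_sub_arctan {x y : ℝ} (hx : 0 ≤ x) (hxy : x ≤ y) :
    (y - x) / (1 + y ^ 2) ≤ Real.arctan y - Real.arctan x := by
  rcases hxy.eq_or_lt with rfl | hlt
  · simp
  obtain ⟨c, hc, hderiv⟩ := exists_hasDerivAt_eq_slope Real.arctan (fun s => 1 / (1 + s ^ 2)) hlt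
    Real.continuous_arctan.continuousOn (fun s _ => Real.hasDerivAt_arctan s)
  have hyx : 0 < y - x := sub_pos.2 hlt
  have hc2 : c ^ 2 ≤ y ^ 2 := pow_le_pow_left₀ (hx.trans hc.1.le) hc.2.le 2
  have h1 : 1 / (1 + y ^ 2) ≤ 1 / (1 + c ^ 2) := one_div_le_one_div_of_le (by positivity) (by linarith)
  rw [hderiv, le_div_iff₀ hyx] at h1
  rw [div_eq_mul_one_div, mul_comm]
  linarith

/-- **THE ARCTAN TELESCOPE**: for `0 ≤ b`, `Σ_{v<K} b∕(1 + b²(v+1)²) ≤ arctan(bK) (< π∕2)` — a Riemann lower sum of the decreasing function `1∕(1+s²)`. [folklore] -/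
private theorem sum_div_one_add_sq_le_arctan {b : ℝ} (hb : 0 ≤ b) (K : ℕ) :
    ∑ v ∈ Finset.range K, b / (1 + b ^ 2 * ((v : ℝ) + 1) ^ 2) ≤ Real.arctan (b * K) := by
  induction K with
  | zero => simp
  | succ K ih =>
    rw [Finset.sum_range_succ, Nat.cast_succ]
    have h := sub_div_le_arctan_sub_arctan (x := b * K) (y := b * ((K : ℝ) + 1)) (by positivity) (by nlinarith)
    have e : (b * ((K : ℝ) + 1) - b * K) / (1 + (b * ((K : ℝ) + 1)) ^ 2) = b / (1 + b ^ 2 * ((K : ℝ) + 1) ^ 2) := by ring_nf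
    rw [e] at h
    linarith

/-- **`Σ_{v<K} 1∕(c(v+1)² + M²) ≤ π∕(2√c·M)`** for `0 < c`, `0 < M`, every `K` (the arctan telescope at `b = √c∕M`) — the one-dimensional momentum sum of a
massive free lattice propagator bounded uniformly in the number of momenta (print bounds the integrand for real momenta, (2.50)–(2.51)). [folklore]
[cite: Balaban1983RegularityDecay, (2.50)–(2.51) p.586] -/
theorem sum_inv_quad_le {c M : ℝ} (hc : 0 < c) (hM : 0 < M) (K : ℕ) :
    ∑ v ∈ Finset.range K, (c * ((v : ℝ) + 1) ^ 2 + M ^ 2)⁻¹ ≤ Real.pi / (2 * (Real.sqrt c * M)) := by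
  have hsc : 0 < Real.sqrt c := Real.sqrt_pos.2 hc
  have hcc : Real.sqrt c ^ 2 = c := Real.sq_sqrt hc.le
  set b : ℝ := Real.sqrt c / M with hb
  have hb0 : 0 ≤ b := by positivity
  have e : ∀ v : ℕ, (c * ((v : ℝ) + 1) ^ 2 + M ^ 2)⁻¹ = (Real.sqrt c * M)⁻¹ * (b / (1 + b ^ 2 * ((v : ℝ) + 1) ^ 2)) := fun v => by
    rw [hb]; field_simp; rw [hcc]; ring
  simp_rw [e]
  rw [← Finset.mul_sum]
  have h := (sum_div_one_add_sq_le_arctan hb0 K).trans (Real.arctan_lt_pi_div_two _).le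
  calc (Real.sqrt c * M)⁻¹ * ∑ v ∈ Finset.range K, b / (1 + b ^ 2 * ((v : ℝ) + 1) ^ 2)
      ≤ (Real.sqrt c * M)⁻¹ * (Real.pi / 2) := mul_le_mul_of_nonneg_left h (by positivity)
    _ = Real.pi / (2 * (Real.sqrt c * M)) := by field_simp

/-- **THE MOMENTUM SUM OVER ONE CIRCLE `ℤ∕n`**: `Σ_{q ∈ ℤ∕n} 1∕(c·v(q)² + M²) ≤ 1∕M² + π∕(√c·M)` with `v(q) = valMinAbs q ∈ (−n∕2, n∕2]` (the zero mode, and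
the two half-circles each bounded by §1's telescope). [folklore] [cite: Balaban1983RegularityDecay, (2.50)–(2.51) p.586] -/
theorem sum_zmod_inv_quad_le (n : ℕ) [NeZero n] {c M : ℝ} (hc : 0 < c) (hM : 0 < M) :
    ∑ q : ZMod n, (c * ((q.valMinAbs : ℤ) : ℝ) ^ 2 + M ^ 2)⁻¹ ≤ (M ^ 2)⁻¹ + Real.pi / (Real.sqrt c * M) := by
  classical
  -- the summand as a function of `|v(q)| : ℕ`
  set g : ℕ → ℝ := fun k => (c * (k : ℝ) ^ 2 + M ^ 2)⁻¹ with hg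
  have hg0 : ∀ k, 0 ≤ g k := fun k => by positivity
  have hterm : ∀ q : ZMod n, (c * ((q.valMinAbs : ℤ) : ℝ) ^ 2 + M ^ 2)⁻¹ = g q.valMinAbs.natAbs := fun q => by
    simp only [hg, Nat.cast_natAbs, Int.cast_abs, sq_abs]
  simp_rw [hterm]
  -- split the circle into `v ≥ 0` and `v < 0`
  rw [← Finset.sum_filter_add_sum_filter_not Finset.univ (fun q : ZMod n => 0 ≤ q.valMinAbs)]
  -- nonnegative half: `q ↦ |v(q)|` is injective into `{0, …, n}`
  have hpos : ∑ q ∈ Finset.univ.filter (fun q : ZMod n => 0 ≤ q.valMinAbs), g q.valMinAbs.natAbs ≤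
      ∑ k ∈ Finset.range (n + 1), g k := by
    rw [← Finset.sum_image (s := Finset.univ.filter (fun q : ZMod n => 0 ≤ q.valMinAbs)) (g := fun q : ZMod n => q.valMinAbs.natAbs) (f := g) ?_]
    · refine Finset.sum_le_sum_of_subset_of_nonneg (fun k hk => ?_) fun k _ _ => hg0 k
      obtain ⟨q, -, rfl⟩ := Finset.mem_image.1 hk
      exact Finset.mem_range.2 (Nat.lt_succ_of_le ((ZMod.natAbs_valMinAbs_le q).trans (Nat.div_le_self n 2)))
    · intro q hq q' hq' h
      have hq0 : 0 ≤ q.valMinAbs := (Finset.mem_filter.1 hq).2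
      have hq0' : 0 ≤ q'.valMinAbs := (Finset.mem_filter.1 hq').2
      have : q.valMinAbs = q'.valMinAbs := by
        have h' := congrArg (fun k : ℕ => (k : ℤ)) h
        simpa only [Int.natAbs_of_nonneg hq0, Int.natAbs_of_nonneg hq0'] using h'
      exact ZMod.valMinAbs_inj.1 this
  -- negative half: `q ↦ |v(q)|` is injective into `{1, …, n}`
  have hneg : ∑ q ∈ Finset.univ.filter (fun q : ZMod n => ¬ 0 ≤ q.valMinAbs), g q.valMinAbs.natAbs ≤
      ∑ k ∈ Finset.range n, g (k + 1) := by
    rw [← Finset.sum_image (s := Finset.univ.filter (fun q : ZMod n => ¬ 0 ≤ q.valMinAbs)) (g := fun q : ZMod n => q.valMinAbs.natAbs) (f := g) ?_]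
    · have hsub : (Finset.univ.filter (fun q : ZMod n => ¬ 0 ≤ q.valMinAbs)).image (fun q : ZMod n => q.valMinAbs.natAbs) ⊆
          (Finset.range n).image (fun k => k + 1) := fun k hk => by
        obtain ⟨q, hq, rfl⟩ := Finset.mem_image.1 hk
        have hq0 : q.valMinAbs < 0 := lt_of_not_ge (Finset.mem_filter.1 hq).2
        have h1 : 1 ≤ q.valMinAbs.natAbs := Int.natAbs_pos.2 hq0.ne
        have h2 : q.valMinAbs.natAbs ≤ n := (ZMod.natAbs_valMinAbs_le q).trans (Nat.div_le_self n 2)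
        refine Finset.mem_image.2 ⟨q.valMinAbs.natAbs - 1, Finset.mem_range.2 (by omega), by omega⟩
      refine (Finset.sum_le_sum_of_subset_of_nonneg hsub fun k _ _ => hg0 k).trans ?_
      rw [Finset.sum_image fun k _ k' _ h => by simpa using h]
    · intro q hq q' hq' h
      have hq0 : q.valMinAbs < 0 := lt_of_not_ge (Finset.mem_filter.1 hq).2
      have hq0' : q'.valMinAbs < 0 := lt_of_not_ge (Finset.mem_filter.1 hq').2
      have : q.valMinAbs = q'.valMinAbs := by
        have h' := congrArg (fun k : ℕ => (k : ℤ)) h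
        simp only [Int.ofNat_natAbs_of_nonpos hq0.le, Int.ofNat_natAbs_of_nonpos hq0'.le, neg_inj] at h'
        exact h'
      exact ZMod.valMinAbs_inj.1 this
  -- the two telescopes
  have htel : ∑ k ∈ Finset.range n, g (k + 1) ≤ Real.pi / (2 * (Real.sqrt c * M)) := by
    have h := sum_inv_quad_le hc hM n
    simp only [hg, Nat.cast_succ] at h ⊢
    exact h
  rw [Finset.sum_range_succ'] at hpos
  have hg0' : g 0 = (M ^ 2)⁻¹ := by simp [hg]
  rw [hg0'] at hpos
  have : Real.pi / (2 * (Real.sqrt c * M)) + Real.pi / (2 * (Real.sqrt c * M)) = Real.pi / (Real.sqrt c * M) := by ring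
  linarith [hpos, hneg, htel]

/-! ## §2 The symbol letter: `2 − 2Re χ_p(e_ν) = 2 − 2cos p′_ν ≥ 16v_ν²∕N_ν²` -/

section Symbol

variable {d : ℕ} (N : Fin d → ℕ) [hN : ∀ μ, NeZero (N μ)]

/-- `2 − 2Re χ_p(e_ν) = 2 − 2cos p′_ν` with the reduced momentum `p′_ν = sOf N p ν = 2π·valMinAbs(p_ν)∕N_ν ∈ [−π, π]` (`2 − 2cos = B4Strip.S1r`, the symbol
`|e^{−ip_ν} − 1|²` of (2.49); `χ_p(e_ν) = e^{2πi p_ν∕N_ν}` by `chi_unitVec`). [cite: Balaban1984PropagatorsI, (1.31) p.23; Balaban1983RegularityDecay, (2.49) p.585] -/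
theorem two_sub_two_re_chi_unitVec (p : Tor N) (ν : Fin d) : 2 - 2 * (chi N p (unitVec N ν)).re = S1r (sOf N p ν) := by
  rw [chi_unitVec]
  conv_lhs => rw [← ZMod.coe_valMinAbs (p ν)]
  rw [ZMod.stdAddChar_coe]
  have e : 2 * (Real.pi : ℂ) * Complex.I * (((p ν).valMinAbs : ℤ) : ℂ) / (N ν : ℂ) = ((sOf N p ν : ℝ) : ℂ) * Complex.I := by
    unfold sOf; push_cast; ring
  rw [e, Complex.exp_ofReal_mul_I_re]
  rfl

/-- **JORDAN AT ONE CIRCLE**: `16t²v_ν²∕N_ν² ≤ t²(2 − 2Re χ_p(e_ν))` (`v_ν = valMinAbs p_ν`; `(4∕π²)p′² ≤ 2 − 2cos p′` for `|p′| ≤ π`, `B4Strip.S1r_ge`) — the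
real-momentum lower bound of the symbol, print's step (2.50). [cite: Balaban1983RegularityDecay, (2.50) p.586; Balaban1984PropagatorsI, (1.31) p.23] -/
theorem letter_le_symbol (t : ℝ) (p : Tor N) (ν : Fin d) :
    16 * t ^ 2 * (((p ν).valMinAbs : ℤ) : ℝ) ^ 2 / (N ν : ℝ) ^ 2 ≤ t ^ 2 * (2 - 2 * (chi N p (unitVec N ν)).re) := by
  rw [two_sub_two_re_chi_unitVec]
  have hN' : (N ν : ℝ) ≠ 0 := by exact_mod_cast NeZero.ne (N ν)
  have h := S1r_ge (sOf N p ν) (abs_sOf_le N p ν)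
  have e : 16 * t ^ 2 * (((p ν).valMinAbs : ℤ) : ℝ) ^ 2 / (N ν : ℝ) ^ 2 = t ^ 2 * (4 * sOf N p ν ^ 2 / Real.pi ^ 2) := by
    unfold sOf; field_simp; ring
  rw [e]
  exact mul_le_mul_of_nonneg_left h (sq_nonneg t)

/-- the one-circle letter is positive: `0 < t²(2 − 2Re χ_p(e_ν)) + m` for `0 < m`. [cite: Balaban1984PropagatorsI, (1.31) p.23] -/
theorem symbol_term_add_pos (t : ℝ) {m : ℝ} (hm : 0 < m) (p : Tor N) (ν : Fin d) : 0 < t ^ 2 * (2 - 2 * (chi N p (unitVec N ν)).re) + m := by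
  have : 0 ≤ t ^ 2 * (2 - 2 * (chi N p (unitVec N ν)).re) :=
    mul_nonneg (sq_nonneg t) (by rw [two_sub_two_re_chi_unitVec]; exact S1r_nonneg _)
  linarith

end Symbol

/-! ## §3 The zone sum: «each factor ≤ Δ_t + m», factorisation over the circles, the telescope per circle -/

section Zone

variable {d : ℕ} (N : Fin d → ℕ) [hN : ∀ μ, NeZero (N μ)]

/-- «EACH FACTOR ≤ Δ_t + m»: `Π_ν (t²(2 − 2Re χ_p(e_ν)) + m) ≤ (Σ_ν t²(2 − 2Re χ_p(e_ν)) + m)^d` for `0 ≤ m`. [cite: Balaban1984PropagatorsI, (1.31) p.23] -/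
theorem prod_symbol_term_le_pow (t : ℝ) {m : ℝ} (hm : 0 ≤ m) (p : Tor N) :
    ∏ ν, (t ^ 2 * (2 - 2 * (chi N p (unitVec N ν)).re) + m) ≤ ((∑ ν, t ^ 2 * (2 - 2 * (chi N p (unitVec N ν)).re)) + m) ^ d := by
  have h0 : ∀ ν, 0 ≤ t ^ 2 * (2 - 2 * (chi N p (unitVec N ν)).re) := fun ν =>
    mul_nonneg (sq_nonneg t) (by rw [two_sub_two_re_chi_unitVec]; exact S1r_nonneg _)
  calc ∏ ν, (t ^ 2 * (2 - 2 * (chi N p (unitVec N ν)).re) + m)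
      ≤ ∏ _ν : Fin d, ((∑ ν, t ^ 2 * (2 - 2 * (chi N p (unitVec N ν)).re)) + m) :=
        Finset.prod_le_prod (fun ν _ => by linarith [h0 ν]) fun ν _ => by
          linarith [Finset.single_le_sum (fun μ _ => h0 μ) (Finset.mem_univ ν)]
    _ = ((∑ ν, t ^ 2 * (2 - 2 * (chi N p (unitVec N ν)).re)) + m) ^ d := by
        rw [Finset.prod_const, Finset.card_univ, Fintype.card_fin]

/-- **THE ZONE SUM (FS-b)** — any dimension `d`, any exponent `k ≥ d`, any `t > 0`, any mass `m > 0`, any torus `Π_ν ℤ∕N_ν`: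
`Σ_{p} ((Σ_ν t²(2 − 2Re χ_p(e_ν)) + m)^k)⁻¹ ≤ (m^{k−d})⁻¹ · Π_ν (m⁻¹ + π·N_ν∕(4t√m))` («each factor ≤ Δ_t + m» and `(Δ_t + m)^{k−d} ≥ m^{k−d}`, then
`Fintype.prod_sum` factorises the zone sum into `d` one-circle sums, each bounded by §1's telescope at `c = 16t²∕N_ν²`). The discrete, volume-uniform form of
the convergence of the free propagator's momentum integral that print bounds for real momenta ((2.50)–(2.51)). [cite: Balaban1983RegularityDecay, (2.50)–(2.51) p.586;
Balaban1984PropagatorsI, (1.29) p.23, (1.31) p.23] -/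
theorem zone_sum_le {k : ℕ} (hk : d ≤ k) {t m : ℝ} (ht : 0 < t) (hm : 0 < m) :
    ∑ p : Tor N, (((∑ ν, t ^ 2 * (2 - 2 * (chi N p (unitVec N ν)).re)) + m) ^ k)⁻¹ ≤
      (m ^ (k - d))⁻¹ * ∏ ν, (m⁻¹ + Real.pi * (N ν : ℝ) / (4 * t * Real.sqrt m)) := by
  -- the one-circle letters as functions of the coordinate residue only
  set a : (ν : Fin d) → ZMod (N ν) → ℝ := fun ν q => t ^ 2 * S1r (2 * Real.pi * ((q.valMinAbs : ℤ) : ℝ) / (N ν : ℝ)) + m with ha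
  have ha_eq : ∀ (p : Tor N) ν, t ^ 2 * (2 - 2 * (chi N p (unitVec N ν)).re) + m = a ν (p ν) := fun p ν => by
    rw [two_sub_two_re_chi_unitVec]; rfl
  have ha0 : ∀ ν q, 0 < a ν q := fun ν q => by
    have : 0 ≤ t ^ 2 * S1r (2 * Real.pi * ((q.valMinAbs : ℤ) : ℝ) / (N ν : ℝ)) := mul_nonneg (sq_nonneg t) (S1r_nonneg _)
    simp only [ha]; linarith
  -- pointwise: `((Δ_t + m)^k)⁻¹ ≤ (m^{k−d})⁻¹ · Π_ν (a_ν)⁻¹`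
  have hpt : ∀ p : Tor N, (((∑ ν, t ^ 2 * (2 - 2 * (chi N p (unitVec N ν)).re)) + m) ^ k)⁻¹ ≤ (m ^ (k - d))⁻¹ * ∏ ν, (a ν (p ν))⁻¹ := fun p => by
    have hS0 : 0 ≤ ∑ ν, t ^ 2 * (2 - 2 * (chi N p (unitVec N ν)).re) :=
      Finset.sum_nonneg fun ν _ => mul_nonneg (sq_nonneg t) (by rw [two_sub_two_re_chi_unitVec]; exact S1r_nonneg _)
    have hP : ∏ ν, a ν (p ν) ≤ ((∑ ν, t ^ 2 * (2 - 2 * (chi N p (unitVec N ν)).re)) + m) ^ d := by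
      have h := prod_symbol_term_le_pow N t hm.le p
      simp_rw [ha_eq] at h ⊢; exact h
    have hPpos : 0 < ∏ ν, a ν (p ν) := Finset.prod_pos fun ν _ => ha0 ν (p ν)
    have hmk : m ^ (k - d) ≤ ((∑ ν, t ^ 2 * (2 - 2 * (chi N p (unitVec N ν)).re)) + m) ^ (k - d) :=
      pow_le_pow_left₀ hm.le (by linarith) _
    rw [Finset.prod_inv_distrib, ← mul_inv]
    refine inv_anti₀ (by positivity) ?_
    calc m ^ (k - d) * ∏ ν, a ν (p ν)
        ≤ ((∑ ν, t ^ 2 * (2 - 2 * (chi N p (unitVec N ν)).re)) + m) ^ (k - d) *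
            ((∑ ν, t ^ 2 * (2 - 2 * (chi N p (unitVec N ν)).re)) + m) ^ d := mul_le_mul hmk hP hPpos.le (by positivity)
      _ = ((∑ ν, t ^ 2 * (2 - 2 * (chi N p (unitVec N ν)).re)) + m) ^ k := by rw [← pow_add, Nat.sub_add_cancel hk]
  -- the one-circle sums
  have h1d : ∀ ν, ∑ q : ZMod (N ν), (a ν q)⁻¹ ≤ m⁻¹ + Real.pi * (N ν : ℝ) / (4 * t * Real.sqrt m) := fun ν => by
    have hNν : (0 : ℝ) < N ν := by exact_mod_cast Nat.pos_of_ne_zero (NeZero.ne (N ν))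
    have hc : 0 < 16 * t ^ 2 / (N ν : ℝ) ^ 2 := by positivity
    have hsm : 0 < Real.sqrt m := Real.sqrt_pos.2 hm
    have hle : ∀ q : ZMod (N ν), (a ν q)⁻¹ ≤ (16 * t ^ 2 / (N ν : ℝ) ^ 2 * ((q.valMinAbs : ℤ) : ℝ) ^ 2 + Real.sqrt m ^ 2)⁻¹ := fun q => by
      refine inv_anti₀ (by positivity) ?_
      rw [Real.sq_sqrt hm.le, ha]
      have hJ := S1r_ge (2 * Real.pi * ((q.valMinAbs : ℤ) : ℝ) / (N ν : ℝ)) ?_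
      · have e : 16 * t ^ 2 / (N ν : ℝ) ^ 2 * ((q.valMinAbs : ℤ) : ℝ) ^ 2 =
            t ^ 2 * (4 * (2 * Real.pi * ((q.valMinAbs : ℤ) : ℝ) / (N ν : ℝ)) ^ 2 / Real.pi ^ 2) := by
          field_simp; ring
        rw [e]
        linarith [mul_le_mul_of_nonneg_left hJ (sq_nonneg t)]
      · -- `|2πv∕N| ≤ π`: the reduced momentum of the class `q` (as `abs_sOf_le` for the one-coordinate torus)
        have h := abs_sOf_le (fun _ : Fin 1 => N ν) (fun _ => q) 0
        simpa [sOf] using h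
    refine (Finset.sum_le_sum fun q _ => hle q).trans ?_
    refine (sum_zmod_inv_quad_le (N ν) hc hsm).trans (le_of_eq ?_)
    have hs : Real.sqrt (16 * t ^ 2 / (N ν : ℝ) ^ 2) = 4 * t / N ν := by
      rw [show 16 * t ^ 2 / (N ν : ℝ) ^ 2 = (4 * t / N ν) ^ 2 by ring, Real.sqrt_sq (by positivity)]
    rw [hs, Real.sq_sqrt hm.le]
    field_simp
  -- assemble
  calc ∑ p : Tor N, (((∑ ν, t ^ 2 * (2 - 2 * (chi N p (unitVec N ν)).re)) + m) ^ k)⁻¹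
      ≤ ∑ p : Tor N, (m ^ (k - d))⁻¹ * ∏ ν, (a ν (p ν))⁻¹ := Finset.sum_le_sum fun p _ => hpt p
    _ = (m ^ (k - d))⁻¹ * ∏ ν, ∑ q : ZMod (N ν), (a ν q)⁻¹ := by
        rw [← Finset.mul_sum, Fintype.prod_sum (fun ν (q : ZMod (N ν)) => (a ν q)⁻¹)]
    _ ≤ (m ^ (k - d))⁻¹ * ∏ ν, (m⁻¹ + Real.pi * (N ν : ℝ) / (4 * t * Real.sqrt m)) :=
        mul_le_mul_of_nonneg_left
          (Finset.prod_le_prod (fun ν _ => Finset.sum_nonneg fun q _ => (inv_pos.2 (ha0 ν q)).le) fun ν _ => h1d ν)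
          (by positivity)

/-- `|T| = Π_ν N_ν` (real cast). [cite: Balaban1984PropagatorsI, (1.29) p.23] -/
theorem card_Tor_eq_prod : (Fintype.card (Tor N) : ℝ) = ∏ ν, (N ν : ℝ) := by
  rw [Fintype.card_pi]; push_cast
  exact Finset.prod_congr rfl fun ν _ => by rw [ZMod.card]

/-- **THE LEVEL-FREE CONSTANT (FS-b)** for the squared resolvent (`k = 4`, `d ≤ 4`): the spectral constant of `B5Eq129FreeResolventSupBound.le_of_double_resolvent_weighted`
obeys `(c₀|T|)⁻¹·Σ_p(Δ_t(p) + m)⁻⁴ ≤ (m^{4−d})⁻¹·c₀⁻¹·Π_ν ((m·N_ν)⁻¹ + π∕(4t√m))` — at the diagonal `c₀t^d = 1`, `N_ν = tℓ_ν` this is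
`m^{d−4}·Π_ν (1∕(mℓ_ν) + π∕(4√m))`: no power of the level, decreasing in the volume, decaying in the mass. [cite: Balaban1984PropagatorsI, (1.29) p.23, Prop. 1.1 p.33;
Balaban1983RegularityDecay, (2.50)–(2.51) p.586] -/
theorem spectral_const_le (hd : d ≤ 4) {t m c₀ : ℝ} (ht : 0 < t) (hm : 0 < m) (hc₀ : 0 < c₀) :
    (∑ p : Tor N, (((∑ ν, t ^ 2 * (2 - 2 * (chi N p (unitVec N ν)).re)) + m) ^ 4)⁻¹) / (c₀ * Fintype.card (Tor N)) ≤
      (m ^ (4 - d))⁻¹ * c₀⁻¹ * ∏ ν, ((m * (N ν : ℝ))⁻¹ + Real.pi / (4 * t * Real.sqrt m)) := by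
  have hz := zone_sum_le N hd ht hm
  have hNpos : ∀ ν, (0 : ℝ) < N ν := fun ν => by exact_mod_cast Nat.pos_of_ne_zero (NeZero.ne (N ν))
  have hT : (0 : ℝ) < ∏ ν, (N ν : ℝ) := Finset.prod_pos fun ν _ => hNpos ν
  rw [card_Tor_eq_prod, div_le_iff₀ (mul_pos hc₀ hT)]
  refine hz.trans (le_of_eq ?_)
  rw [show (m ^ (4 - d))⁻¹ * c₀⁻¹ * (∏ ν, ((m * (N ν : ℝ))⁻¹ + Real.pi / (4 * t * Real.sqrt m))) * (c₀ * ∏ ν, (N ν : ℝ)) =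
      (m ^ (4 - d))⁻¹ * (c₀⁻¹ * c₀) * ((∏ ν, ((m * (N ν : ℝ))⁻¹ + Real.pi / (4 * t * Real.sqrt m))) * ∏ ν, (N ν : ℝ)) by ring,
    inv_mul_cancel₀ hc₀.ne', mul_one, ← Finset.prod_mul_distrib]
  congr 1
  refine Finset.prod_congr rfl fun ν _ => ?_
  have hN' : (N ν : ℝ) ≠ 0 := (hNpos ν).ne'
  field_simp

end Zone

end Literature.MathematicalPhysics.QuantumFieldTheory.Balaban1983to89.B5Eq129FreeResolventZoneSum

end
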